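import Summits.QuantumFields.YangMills.Theorems.BalabanUVNodesN15KingModelLandauFlux
import HarnessLib

/-!
# BalabanUVNodes ∕ N15 — THE KING-MODEL RUNG (PART Ϡ-m): CARTAN CONSTANT CURVATURE — a `U(n)`-valued link field in the MAXIMAL TORUS, `U(x,μ) = diag_a(U^{(a)}(x,μ))` with each colour `a` a
# `U(1)` constant-flux field of PART Ͻ-q (flux momentum `P_a`, Landau gauge `(P_a)_{ν₁} = 0`): King's covariant fine operator on the fibre `ℂⁿ` has the Landau gap of its LEAST CURVED COLOUR,
# `Re⟨v,(−cΔ_U+m²)v⟩ ≥ (m² + c·min_aΛ(p′_a))‖v‖²`, and a flux-free colour kills the massless gap — the first genuinely MATRIX-valued curved background of PART Ϡ (commuting curvature)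
# (Track A, DAG node N15 = NE2; FAN-OUT v1.1 §N15 s3 «KING-MODEL RUNG … + what the curved case adds»; count-neutral)

HONEST FRAMING.  Count-neutral (cell `pub-ymgap`, seat `pub-ymgap-dag-n15-e` g47; `--supports stmt-QuantumFields-27247 --as helper` = K3ᴬ, KEY MAP v3).  King's fine covariance layer `−cΔ_U + m²`
([King1986] symbol (4.4) p.670; [Balaban1985BackgroundPropagators] (3.3) p.391, (3.23) p.394) at a link field with values in a maximal torus of `U(n)` (simultaneously diagonal; the reading of the tree's
`B5ToronOperators118` ∕ PART Ͷ-i `cartanLink` for CURVED colour fields); the covariant Dirichlet form (Ͱ-d) decouples colour by colour and PART Ϡ-b applies per colour.  Genuinely non-commuting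
constant curvature is NOT treated.  NOT Bałaban's `G_k(U)`; NOT a node discharge (N15 of record untouched); nothing continuum-YM ∕ ℝ⁴ ∕ OS ∕ Clay.

THE RESULTS (`ν₀ ≠ ν₁`, `c ≥ 0`, colours `a : n`, `P : n → Tor K` with `(P_a)_{ν₁} = 0`):
* `cartanFluxLink` (def: `diag_a (fluxLink (P a) ν₁)(x,μ)`), `cartanFluxLink_apply_entry`, `cartanFluxLink_mem_unitaryGroup`, ★ `norm_sq_fib_sub_diagonal` (a DIAGONAL transporter acts colour by colour:
  `‖v_x − diag(w)v_y‖² = Σ_a|v(x,a) − w_a v(y,a)|²`), `sum_norm_fib_sq_eq_colours` (`Σ_x‖v_x‖² = Σ_aΣ_x|v(x,a)|²`);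
* ★★★ **`re_quadForm_covLapF_cartanFlux_ge_landau`**: `κ ≤ Λ(p′_a)` for every colour ⟹ `(m² + cκ)·Σ‖v_x‖² ≤ Re⟨v,(−cΔ_U+m²)v⟩` (Ϡ-b `landau_torus_bound` colour by colour); ★★
  `eigenvalues_covLapF_cartanFlux_ge`, ★★ **`posDef_covLapF_cartanFlux_massless`** (`c > 0`, every colour carries a non-zero flux with `|p′_a| ≤ 1`: the massless operator is positive definite with gap
  `≥ c·min_a|p′_a|∕4`);
* ★★ **`not_posDef_covLapF_cartanFlux_massless_of_flat_colour`** (`c` any, some colour with `P_a = 0`: the constants of that colour are zero modes — the Cartan gap is EXACTLY the least curved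
  colour's, and vanishes with it).
PRIOR TREE ART (by name): Ϡ-a (`landauGap`, `landauGap_ge_quarter`, `landauGap_pos`), Ϡ-b (`landau_torus_bound`), Ϡ-c (`eigenvalues_covLapF_ge_of_coercive`, `posDef_covLapF_of_coercive`, `landauGap_sOf_pos`), Ͱ-a
(`covLapF`), Ͱ-b (`fib`, `fib_apply`), Ͱ-d (`re_quadForm_covLapF`), Ͷ-c (`chi_mul_conj`), Ͻ-q (`fluxLink`), `TorusSpectral.norm_chi_eq_one`, `B5Prop11Plancherel` (`Tor`, `unitVec`, `chi`, `sOf`), Mathlib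
(`EuclideanSpace.norm_sq_eq`, `Matrix.mulVec_diagonal`, `Matrix.mem_unitaryGroup_iff`).  Dedup (rg at filing): basename 0 files; needles `cartanFluxLink|_cartanFlux_|norm_sq_fib_sub_diagonal|sum_norm_fib_sq_eq_colours`
0 tree files.  Locators: [King1986] symbol (4.4) p.670, (2.12) p.653; [Balaban1985BackgroundPropagators] (3.3) p.391, (3.23) p.394; [Balaban1984PropagatorsI] (1.29) p.23.  0 `sorry`, 1 `def`.
-/

noncomputable section
open scoped BigOperators ComplexConjugate ComplexOrder
open Finset Matrix WithLp

namespace Summit.QuantumFields.YangMills.BalabanUVNodes.N15KingModelRung.Landau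

open Literature.MathematicalPhysics.QuantumFieldTheory.Balaban1983to89.B5Prop11Plancherel (Tor unitVec chi sOf)
open Summit.QuantumFields.YangMills.BalabanUVNodes.N15KingModelRung.Covariant (covLapF fib fib_apply isHermitian_covLapF re_quadForm_covLapF)
open Summit.QuantumFields.YangMills.BalabanUVNodes.N15KingModelRung.Cover (fluxLink)
open Summit.QuantumFields.YangMills.BalabanUVNodes.N15KingModelRung.TorusSpectral (norm_chi_eq_one)

variable {d : ℕ} (K : Fin (d + 1) → ℕ) [hK : ∀ μ, NeZero (K μ)]
variable {n : Type*} [Fintype n] [DecidableEq n]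

/-! ## §1 The Cartan constant-flux field -/

/-- THE CARTAN CONSTANT-FLUX FIELD: `U(x,μ) = diag_a(fluxLink (P a) ν₁ (x,μ))` — each colour `a` carries its own `U(1)` constant flux `χ_{P_a}`, all in one maximal torus of `U(n)`.
[cite: King1986, (2.12) p.653; Balaban1985BackgroundPropagators, (3.3) p.391] -/
def cartanFluxLink (P : n → Tor K) (ν₁ : Fin (d + 1)) : Tor K × Fin (d + 1) → Matrix n n ℂ :=
  fun b => Matrix.diagonal fun a => fluxLink K (P a) ν₁ b () ()

/-- The `U(1)` flux entry: `fluxLink p ν₁ (x,μ) = χ_p(x)` for `μ = ν₁`, `1` otherwise. [folklore] -/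
theorem fluxLink_entry (p : Tor K) (ν₁ : Fin (d + 1)) (b : Tor K × Fin (d + 1)) : fluxLink K p ν₁ b () () = if b.2 = ν₁ then chi K p b.1 else 1 := by
  unfold fluxLink; split_ifs <;> simp

/-- `|fluxLink p ν₁ b| = 1`. [folklore] -/
theorem norm_fluxLink_entry (p : Tor K) (ν₁ : Fin (d + 1)) (b : Tor K × Fin (d + 1)) : ‖fluxLink K p ν₁ b () ()‖ = 1 := by
  rw [fluxLink_entry]; split_ifs
  · exact norm_chi_eq_one K p b.1
  · exact norm_one

omit hK in
/-- A diagonal matrix of unit complex numbers is unitary. [folklore] -/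
theorem diagonal_mem_unitaryGroup {w : n → ℂ} (hw : ∀ a, ‖w a‖ = 1) : Matrix.diagonal w ∈ Matrix.unitaryGroup n ℂ := by
  refine Matrix.mem_unitaryGroup_iff.mpr ?_
  rw [star_eq_conjTranspose, diagonal_conjTranspose, diagonal_mul_diagonal, ← diagonal_one]
  congr 1; funext a
  have h := hw a
  rw [Pi.star_apply, Complex.star_def, Complex.mul_conj, Complex.normSq_eq_norm_sq, h]; norm_num

/-- The Cartan flux field is unitary. [folklore] -/
theorem cartanFluxLink_mem_unitaryGroup (P : n → Tor K) (ν₁ : Fin (d + 1)) (b : Tor K × Fin (d + 1)) : cartanFluxLink K P ν₁ b ∈ Matrix.unitaryGroup n ℂ :=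
  diagonal_mem_unitaryGroup fun a => norm_fluxLink_entry K (P a) ν₁ b

omit hK in
/-- ★ A DIAGONAL TRANSPORTER ACTS COLOUR BY COLOUR: `‖v_x − diag(w)·v_y‖² = Σ_a|v(x,a) − w_a·v(y,a)|²`. [folklore] -/
theorem norm_sq_fib_sub_diagonal (w : n → ℂ) (v : Tor K × n → ℂ) (x y : Tor K) :
    ‖fib K v x - Matrix.toEuclideanLin (Matrix.diagonal w) (fib K v y)‖ ^ 2 = ∑ a, ‖v (x, a) - w a * v (y, a)‖ ^ 2 := by
  rw [EuclideanSpace.norm_sq_eq]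
  refine Finset.sum_congr rfl fun a _ => ?_
  rw [PiLp.sub_apply, fib_apply, Matrix.toLpLin_apply, PiLp.toLp_apply, mulVec_diagonal]
  rfl

omit hK [DecidableEq n] in
/-- `Σ_x‖v_x‖² = Σ_aΣ_x|v(x,a)|²`. [folklore] -/
theorem sum_norm_fib_sq_eq_colours [∀ μ, NeZero (K μ)] (v : Tor K × n → ℂ) : ∑ x, ‖fib K v x‖ ^ 2 = ∑ a, ∑ x, ‖v (x, a)‖ ^ 2 := by
  rw [Finset.sum_comm]
  exact Finset.sum_congr rfl fun x _ => by rw [EuclideanSpace.norm_sq_eq]; rfl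

/-! ## §2 The Landau gap of the least curved colour -/

section Gap

variable {c : ℝ}

/-- ★★★ **THE CARTAN LANDAU GAP**: `ν₀ ≠ ν₁`, `(P_a)_{ν₁} = 0` and `κ ≤ Λ(p′_{a,ν₀})` for every colour `a`, `c ≥ 0` ⟹ `(m² + cκ)·Σ‖v_x‖² ≤ Re⟨v,(−cΔ_U+m²)v⟩` at `U = cartanFluxLink P ν₁` — the gap of
a commuting constant-curvature `U(n)` field is that of its least curved colour. [cite: King1986, (4.4) p.670, (2.12) p.653; Balaban1985BackgroundPropagators, (3.23) p.394] -/
theorem re_quadForm_covLapF_cartanFlux_ge_landau (hc : 0 ≤ c) (m2 : ℝ) {ν₀ ν₁ : Fin (d + 1)} (hν : ν₀ ≠ ν₁) {P : n → Tor K} (hP : ∀ a, P a ν₁ = 0) {κ : ℝ}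
    (hκ : ∀ a, κ ≤ landauGap (sOf K (P a) ν₀)) (v : Tor K × n → ℂ) :
    (m2 + c * κ) * ∑ x, ‖fib K v x‖ ^ 2 ≤ RCLike.re (star v ⬝ᵥ (covLapF K c m2 (cartanFluxLink K P ν₁) *ᵥ v)) := by
  rw [re_quadForm_covLapF K c m2 (cartanFluxLink_mem_unitaryGroup K P ν₁) v]
  -- colourwise Landau bound
  have hcol : ∀ a, landauGap (sOf K (P a) ν₀) * ∑ x, ‖v (x, a)‖ ^ 2
      ≤ ∑ x, (‖v (x, a) - v (x + unitVec K ν₀, a)‖ ^ 2 + ‖v (x, a) - chi K (P a) x * v (x + unitVec K ν₁, a)‖ ^ 2) :=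
    fun a => landau_torus_bound K ν₀ (hP a) (fun x => v (x, a))
  -- the two directions inside the full covariant kinetic term, colour by colour
  have hkin : ∑ a, ∑ x, (‖v (x, a) - v (x + unitVec K ν₀, a)‖ ^ 2 + ‖v (x, a) - chi K (P a) x * v (x + unitVec K ν₁, a)‖ ^ 2)
      ≤ ∑ x, ∑ μ, ‖fib K v x - Matrix.toEuclideanLin (cartanFluxLink K P ν₁ (x, μ)) (fib K v (x + unitVec K μ))‖ ^ 2 := by
    have hexp : ∀ x μ, ‖fib K v x - Matrix.toEuclideanLin (cartanFluxLink K P ν₁ (x, μ)) (fib K v (x + unitVec K μ))‖ ^ 2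
        = ∑ a, ‖v (x, a) - fluxLink K (P a) ν₁ (x, μ) () () * v (x + unitVec K μ, a)‖ ^ 2 := fun x μ => norm_sq_fib_sub_diagonal K _ v x _
    simp_rw [hexp]
    rw [Finset.sum_comm]
    refine Finset.sum_le_sum fun x _ => ?_
    rw [Finset.sum_comm]
    refine Finset.sum_le_sum fun a _ => ?_
    have h2 := sum_two_dirs_le_sum hν (F := fun μ => ‖v (x, a) - fluxLink K (P a) ν₁ (x, μ) () () * v (x + unitVec K μ, a)‖ ^ 2) (fun μ => sq_nonneg _)
    simp only [fluxLink_entry, if_neg hν, one_mul] at h2 ⊢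
    exact h2
  have hsum : κ * ∑ x, ‖fib K v x‖ ^ 2 ≤ ∑ a, ∑ x, (‖v (x, a) - v (x + unitVec K ν₀, a)‖ ^ 2 + ‖v (x, a) - chi K (P a) x * v (x + unitVec K ν₁, a)‖ ^ 2) := by
    rw [sum_norm_fib_sq_eq_colours, Finset.mul_sum]
    exact Finset.sum_le_sum fun a _ => le_trans (mul_le_mul_of_nonneg_right (hκ a) (Finset.sum_nonneg fun _ _ => sq_nonneg _)) (hcol a)
  have hS : 0 ≤ ∑ x, ‖fib K v x‖ ^ 2 := Finset.sum_nonneg fun _ _ => sq_nonneg _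
  nlinarith [mul_le_mul_of_nonneg_left (hsum.trans hkin) hc]

/-- ★★ Every eigenvalue of `−cΔ_U+m²` at the Cartan flux field is `≥ m² + cκ`. [cite: King1986, (4.4) p.670] -/
theorem eigenvalues_covLapF_cartanFlux_ge (hc : 0 ≤ c) (m2 : ℝ) {ν₀ ν₁ : Fin (d + 1)} (hν : ν₀ ≠ ν₁) {P : n → Tor K} (hP : ∀ a, P a ν₁ = 0) {κ : ℝ}
    (hκ : ∀ a, κ ≤ landauGap (sOf K (P a) ν₀)) (i : Tor K × n) : m2 + c * κ ≤ (isHermitian_covLapF K c m2 (cartanFluxLink K P ν₁)).eigenvalues i :=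
  eigenvalues_covLapF_ge_of_coercive K c m2 _ (fun v => re_quadForm_covLapF_cartanFlux_ge_landau K hc m2 hν hP hκ v) i

/-- ★★ **ALL COLOURS CURVED ⟹ A MASSLESS GAP**: `c > 0`, every colour with `(P_a)_{ν₀} ≠ 0`, `|p′_a| ≤ 1` and a common `0 < t ≤ |p′_a|` ⟹ `−cΔ_U ≻ 0` with every eigenvalue `≥ ct∕4`.
[cite: King1986, (4.4) p.670; DodziukMathai2006, Cor 1.3 §1] -/
theorem posDef_covLapF_cartanFlux_massless (hc : 0 < c) {ν₀ ν₁ : Fin (d + 1)} (hν : ν₀ ≠ ν₁) {P : n → Tor K} (hP : ∀ a, P a ν₁ = 0) (hsmall : ∀ a, |sOf K (P a) ν₀| ≤ 1)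
    {t : ℝ} (ht : 0 < t) (hta : ∀ a, t ≤ |sOf K (P a) ν₀|) : (covLapF K c 0 (cartanFluxLink K P ν₁)).PosDef :=
  posDef_covLapF_of_coercive K c 0 _ (κ := 0 + c * (t / 4)) (by rw [zero_add]; positivity)
    fun v => re_quadForm_covLapF_cartanFlux_ge_landau K hc.le 0 hν hP (fun a => le_trans (by linarith [hta a]) (landauGap_ge_quarter (hsmall a))) v

end Gap

/-! ## §3 A flux-free colour kills the massless gap -/

section Flat

/-- ★★ **A FLAT COLOUR IS A ZERO MODE**: if some colour `a₀` carries no flux (`P_{a₀} = 0`) then the MASSLESS operator `−cΔ_U` at the Cartan flux field is NOT positive definite (the constant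
field in colour `a₀` has zero covariant energy) — the Cartan gap is exactly the least curved colour's. [cite: King1986, (4.4) p.670; Balaban1985BackgroundPropagators, (3.23) p.394] -/
theorem not_posDef_covLapF_cartanFlux_massless_of_flat_colour (c : ℝ) (ν₁ : Fin (d + 1)) {P : n → Tor K} {a₀ : n} (ha : P a₀ = 0) :
    ¬ (covLapF K c 0 (cartanFluxLink K P ν₁)).PosDef := by
  intro hpd
  -- the constant field in colour `a₀`
  set v : Tor K × n → ℂ := fun z => if z.2 = a₀ then 1 else 0 with hv
  have hvne : v ≠ 0 := fun h0 => by
    have := congr_fun h0 ((0 : Tor K), a₀)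
    simp [hv] at this
  have hpos := hpd.re_dotProduct_pos hvne
  have hform := re_quadForm_covLapF K c 0 (cartanFluxLink_mem_unitaryGroup K P ν₁) v
  have hzero : ∀ x μ, ‖fib K v x - Matrix.toEuclideanLin (cartanFluxLink K P ν₁ (x, μ)) (fib K v (x + unitVec K μ))‖ ^ 2 = 0 := by
    intro x μ
    rw [show cartanFluxLink K P ν₁ (x, μ) = Matrix.diagonal (fun a => fluxLink K (P a) ν₁ (x, μ) () ()) from rfl, norm_sq_fib_sub_diagonal]
    refine Finset.sum_eq_zero fun a _ => ?_
    by_cases h : a = a₀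
    · subst h
      simp only [hv, if_true, mul_one, fluxLink_entry, ha]
      split_ifs
      · rw [show chi K (0 : Tor K) x = 1 by unfold chi; simp]; simp
      · simp
    · simp [hv, h]
  simp_rw [hzero] at hform
  simp only [Finset.sum_const_zero, mul_zero, add_zero, zero_mul] at hform
  rw [hform] at hpos
  exact lt_irrefl _ hpos

end Flat

end Summit.QuantumFields.YangMills.BalabanUVNodes.N15KingModelRung.Landau

end
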